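import Literature.NumberTheory.EllipticCurves.Fisher2016.CongruentKummerConditions
import HarnessLib

/-!
# Mazur–Rubin 2015, Thm. 3.1 (iv)(b) / §5.3 / §6 Case 5: the local Kummer conditions of `p`-congruent
# elliptic curves agree at a place ABOVE `p` where BOTH curves have GOOD reduction (`e < p − 1`)

Topic `NumberTheory/EllipticCurves`, sub-directory `MazurRubin2015` (author–year); namespace
`Literature.NumberTheory.EllipticCurves.MazurRubin2015`. ONE named fact (`def … : Prop`, D-0014: a
published theorem with proof, transcribed, not proved here) + proved corollaries. Written for the cell
`b2b-bsdres` (run/shared/lean/b2b/bsd-rank1-residual/; supersingular family prover A, unit `b2b-bsdres-x10b`,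
gen 15), whose HONEST FRAMING applies to its use there: the goal of that cell is to DELETE the
COMBINATION-SHAPED residual classes for ALL analytic-rank `≤ 1` elliptic curves over `ℚ` — "full BSD formula
for every rank `≤ 1` curve in class C" assembled STRICTLY from published theorems — so that the rank-`≤ 1`
remainder becomes exactly the CONSTRUCTION-SHAPED classes, which are TYPED (missing-input `Prop`s), NOT
attempted; this is not "finishing BSD". Use in the cell: the FIFTH free kind of place in the per-curve
visibility certificate (`WeierstrassCurve.exists_sha_ne_zero_of_congr_of_places₄`,
`Fisher2016/CongruentKummerConditions.lean`): besides (i) `v ∤ p`, `E'(K_v)[p] = 0`, (ii) both curves split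
multiplicative, (iii) both multiplicative of the same `γ`-class, (iv) one non-split multiplicative / the other
good (Fisher 2016 Thm. 4.4), now also **(v) `v ∣ p`, `e(v|p) < p − 1`, and BOTH curves of GOOD reduction at `v`**
— the place `p` itself of a pair of `p`-congruent curves good at `p`, which the count of
`CongruenceVisibilityLocalFactors.lean` charges `p^{[K_v:ℚ_p]} · #E'(K_v)[p]` ("finite-flat comparison not
available in the tree", module docstring of `CongruenceVisibilityRefinedCertificate.lean`). This is the case of
every supersingular (X6/X7/X8) and good-ordinary rank-`0` pair of the cell whose partner is also good at `p`.

## Source (B. Mazur, K. Rubin, *Selmer companion curves*, Trans. Amer. Math. Soc. 367 (2015) 401–421 =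
## arXiv:1203.0620; held text = the arXiv source, store key `paper:arxiv-1203.0620`, whose running item
## numbers are quoted in brackets; the journal numbers sections — Thm. 3.1 is the main theorem of §3 — and
## items: JOURNAL CONCORDANCE (version of record, Trans. AMS 367, pp. 411–414) Prop. [27] = Prop. 5.8
## (p. 411) · Remark [28] = Remark 5.9 (p. 411) · Thm. [29] = Thm. 6.1 (pp. 411–412) · Def. [30] = Def. 6.2
## (p. 412) · proof of Thm. 6.1 Case 5 = p. 413 · proof of Thm. 3.1 (Raynaud paragraph) = p. 414, where
## Raynaud is cited as printed «[20, §3.5.5]» ([20] = Bull. Soc. Math. France 102 (1974) 241–280))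

§5 standing (first lines): "For this section let `K` be a finite extension of `ℚ_ℓ` or of `ℝ`. Fix a rational
prime power `p^k`. For every elliptic curve `E/K`, let `κ_E = κ_{E/K}` denote the Kummer map
`κ_{E/K} : E(K) → H¹(K, E[p^k])`."

§5.3 "The group scheme kernel of `p^k`": "Let `𝒪` be the ring of integers of `K` and `𝔽` the residue field.
Let `𝓔` be the Néron model of `E`, so `𝓔` is a smooth group scheme over `𝒪`. … Let `𝓔[p^k]` the kernel of
multiplication by `p^k` on `𝓔`; this is a group scheme over `𝒪` with finite generic fiber."
**Proposition [27] (= Prop. 5.8, p. 411).** "Suppose that multiplication by `p` induces a faithfully flat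
morphism `𝓔 → 𝓔` over `𝒪`. Then `𝓔[p^k]` is a quasi-finite flat group scheme over `𝒪`, and `image(κ_E)` is
the image of the composition `H¹_fppf(Spec(𝒪), 𝓔[p^k]) → H¹_fppf(Spec(K), 𝓔[p^k]) ≅ H¹(K, E[p^k])` where
`H¹_fppf` means cohomology of abelian group schemes, computed in the fppf topology." (Proof from [rpav] =
Mazur, *Rational points of abelian varieties with values in towers of number fields*.) **Remark [28]
(= Remark 5.9, p. 411).** "If `K` has residue characteristic `p`, then multiplication by `p` induces a
faithfully flat endomorphism of `𝓔` if and only if `E` has good or multiplicative reduction and `p` does not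
divide the order of `Φ`."

§6, **Definition [30] (= Def. 6.2, p. 412).** "The `p^k`-Selmer group `Sel_{p^k}(E/K) ⊂ H¹(K, E[p^k])` of an
elliptic curve `E` over `K` is `Sel_{p^k}(E/K) := ker(H¹(K, E[p^k]) → ⊕_v H¹(K_v, E[p^k])/image(κ_{E/K_v}))`.
A `G_K`-isomorphism `E₁[p^k] ≅ E₂[p^k]` allows us to identify `H¹(K, E₁[p^k]) = H¹(K, E₂[p^k])`,
`H¹(K_v, E₁[p^k]) = H¹(K_v, E₂[p^k])` for every `v`. We will show that under the hypotheses of Theorems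
[3.1] and [29], with these identifications, for every `v` and for every `χ ∈ 𝒳(K_v)`, the images of the
horizontal Kummer maps `E_i^χ(K_v) → H¹(K_v, E_i[p^k])` are equal."
**Theorem [29] (= Thm. 6.1, pp. 411–412)** (the "slightly stronger version of Theorem 3.1"), hypothesis (iv),
second bullet: "`p > 2`, `E₁` and `E₂` have good reduction at `v`, and the isomorphism of (i) extends to an
isomorphism `𝓔₁[p^k] ≅ 𝓔₂[p^k]` over `Spec(𝒪_{K_v})`, where the group scheme `𝓔_i[p^k]` is the kernel of
multiplication by `p^k` in the Néron model of `E_i`." Proof, **Case 5** (p. 413): "`v ∣ p`, `p > 2`, `E₁` and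
`E₂` have good reduction at `v`, and the isomorphism `E₁[p^k] ≅ E₂[p^k]` extends to an isomorphism
`𝓔₁[p^k] ≅ 𝓔₂[p^k]`. In this case Proposition [27] shows that `image(κ_{E₁/K_v}) = image(κ_{E₂/K_v})`."
**Proof of Theorem 3.1** (last paragraph of §6, p. 414): "Suppose `k = 1`, `𝔭 ∣ p`, `E₁, E₂` have good
reduction at `𝔭`, and the ramification `e(𝔭/p) < p − 1` (so in particular `p > 2`). By Raynaud's theorem
[printed «[20, §3.5.5]»: Raynaud, *Schémas en groupes de type (p,…,p)*, Bull. SMF 102 (1974)], the group scheme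
`𝓔_i[p]` is determined by the Galois module `E_i[p]`. Hence in this case the isomorphism `E₁[p] ≅ E₂[p]`
necessarily extends to an isomorphism `𝓔₁[p] ≅ 𝓔₂[p]`." **Theorem 3.1** (pp. 404–405), hypothesis (iv): "for
every `𝔭` of `K` above `p`, either (a) `𝔭 ∈ S₁ = S₂` [potentially multiplicative], or (b) `k = 1`, `E₁` and `E₂`
have good reduction at `𝔭`, and the ramification degree `e(𝔭/p)` is less than `p − 1`"; hypothesis (i): "there
is a `G_K`-isomorphism `E₁[m] ≅ E₂[m]`" (`m = p^k` for `p > 3`).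

## Transcription (the tree's vocabulary = that of `CongruenceVisibilityComparison.lean`, exactly as in
## `Fisher2016/CongruentKummerConditions.lean`)

* `K` a number field, `E = W`, `E' = W'` elliptic curves over `K`, `p` an odd prime (`k = 1`),
  `θ : E'[p] ⥲ E[p]` a `Γ_K`-equivariant additive isomorphism of the geometric `p`-torsion
  (`WeierstrassCurve.geomTorsion`; the printed hypothesis (i) is a `G_K`-isomorphism), `v` a finite place ABOVE
  `p` (`(p : 𝓞 K) ∈ v.asIdeal`) with `e(v|p) = v.asIdeal.ramificationIdx ℤ < p − 1` (the ramification index of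
  `K_v/ℚ_p` is that of `v` over `p`), both curves of GOOD reduction at `v` (`HasGoodReductionAt v`). "The images
  of the Kummer maps are equal in `H¹(K_v, E₁[p]) = H¹(K_v, E₂[p])`" is read on GLOBAL classes through
  restriction: `𝓢_v(E) = W.selmerLocalKer K_v p = ker(H¹(K, E[p]) → H¹(K_v, E(K̄_v)))` (by Kummer exactness
  `= res_v⁻¹(image κ_{E/K_v})`) and `θ_* = h1Equiv θ hθ` on `H¹(K, ·)`; since `res_v ∘ θ_* = θ_* ∘ res_v`
  one gets, for every `c ∈ H¹(K, E'[p])`: `c ∈ 𝓢_v(E') ↔ θ_* c ∈ 𝓢_v(E)`. THIS equivalence is what is stated —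
  the conjunction of Case 5 with the Raynaud paragraph (the `k = 1`, `e < p − 1` clause of Thm. 3.1 (iv)(b)),
  for restrictions of global classes (weaker than print: nothing is claimed about local classes that are not
  restrictions, about `k ≥ 2`, or about the twists `E^χ`).
`-- TODO(general form): k ≥ 2 (hypothesis: the isomorphism E₁[p^k] ≅ E₂[p^k] EXTENDS to the finite flat`
`-- group schemes 𝓔₁[p^k] ≅ 𝓔₂[p^k] over 𝒪_{K_v}; Thm. [29] (iv)), and the twisted statement for E^χ.`

## Proved here (no further fact)

* `selmerLocalKer_le_of_goodReduction_above` — the `hagree`-shaped projection consumed by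
  `exists_sha_ne_zero_of_congr_of_le_off`;
* `selmerLocalKer_iff_of_goodReduction_above_rat` — over `ℚ` the ramification clause is automatic
  (`e = 1 < p − 1` for odd `p`; `Fisher2016.ramificationIdx_int_rat_eq_one`);
* `WeierstrassCurve.exists_sha_ne_zero_of_congr_of_places₅` and its `ℚ`-form `…_of_places₅_rat` — the refined
  certificate of `CongruentKummerConditions.lean` with the FIFTH free kind (v) added (same proof, one more case):
  over `ℚ`, a rank-`0` curve `E` with `#E(ℚ)` prime to `p` and a `p`-congruent partner `E'`, BOTH GOOD AT `p`,
  pay NOTHING at `p`.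

## References

* [MazurRubin2015SelmerCompanions] B. Mazur, K. Rubin, Trans. Amer. Math. Soc. 367 (2015) 401–421, Thm. 3.1
  (iv)(b) (pp. 404–405); §5 (Kummer map), §5.3 Proposition [27] = Prop. 5.8 and Remark [28] = Remark 5.9
  (p. 411); §6 Definition [30] = Def. 6.2 (p. 412), Thm. [29] = Thm. 6.1 (iv) (pp. 411–412), proof Case 5
  (p. 413), proof of Thm. 3.1 (p. 414) (bracketed numbers = running numbers of arXiv:1203.0620; the others =
  the journal's, version of record).
* M. Raynaud, *Schémas en groupes de type (p, …, p)*, Bull. Soc. Math. France 102 (1974) 241–280, Thm. 3.3.3,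
  Cor. 3.3.6 — cited by Mazur–Rubin as printed «[20, §3.5.5]» (journal) = [raynaud] (arXiv).
* [Cesnavicius2016SelmerFlat] K. Česnavičius, J. Ramanujan Math. Soc. 31 (2016) 31–61, Prop. 2.5 / (sel-ind-nf)
  (c) — the same local comparison in the language of flat cohomology (not used here).
* [CremonaMazur2000] §3; [AgasheStein2002] Thm. 3.1 and §3.5, Case 3 of the proof (`char(v) = p`, abelian
  reduction, `e < p − 1`) — the same step inside the visibility theorem.
-/

set_option autoImplicit false

noncomputable section

open scoped Classical

open NumberField IsDedekindDomain Field WeierstrassCurve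

namespace Literature.NumberTheory.EllipticCurves.MazurRubin2015

/-- **Mazur–Rubin, Trans. AMS 367 (2015), Thm. 3.1 (iv)(b) with §5.3 Prop. [27] = Prop. 5.8 and §6 Case 5
(proof of Thm. [29] = Thm. 6.1)** (local
Kummer conditions of `p`-congruent curves agree at a place above `p` where both have GOOD reduction and
`e(v|p) < p − 1`), read on restrictions of global classes. For a number field `K`, elliptic curves `E = W`,
`E' = W'` over `K`, an odd prime `p`, a `Γ_K`-equivariant isomorphism `θ : E'[p] ⥲ E[p]`, and a finite place
`v ∣ p` with `e(v|p) < p − 1` at which BOTH curves have good reduction: a class `c ∈ H¹(K, E'[p])` satisfies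
the local Kummer (Selmer) condition of `E'` at `v` iff `θ_* c` satisfies that of `E` at `v`. As printed (§6,
proof of Thm. [29] = Thm. 6.1, Case 5, p. 413): "`v ∣ p`, `p > 2`, `E₁` and `E₂` have good reduction at `v`,
and the isomorphism `E₁[p^k] ≅ E₂[p^k]` extends to an isomorphism `𝓔₁[p^k] ≅ 𝓔₂[p^k]`. In this case
Proposition [27] shows that `image(κ_{E₁/K_v}) = image(κ_{E₂/K_v})`" — Prop. [27] = Prop. 5.8 (p. 411):
"Suppose that multiplication by `p` induces a faithfully flat morphism `𝓔 → 𝓔` over `𝒪`. Then … `image(κ_E)`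
is the image of the composition `H¹_fppf(Spec(𝒪), 𝓔[p^k]) → H¹_fppf(Spec(K), 𝓔[p^k]) ≅ H¹(K, E[p^k])`" (good
reduction ⇒ faithfully flat, Remark [28] = Remark 5.9) — and (proof of Thm. 3.1, p. 414): "Suppose `k = 1`,
`𝔭 ∣ p`, `E₁, E₂` have good reduction at `𝔭`, and the ramification `e(𝔭/p) < p − 1` (so in particular
`p > 2`). By Raynaud's theorem [20, §3.5.5], the group scheme `𝓔_i[p]` is determined by the Galois module
`E_i[p]`. Hence in this case the isomorphism `E₁[p] ≅ E₂[p]` necessarily extends to an isomorphism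
`𝓔₁[p] ≅ 𝓔₂[p]`." Named fact, NOT proved here (finite flat group
schemes / fppf cohomology / Raynaud's theorem are not in the tree).
[cite: MazurRubin2015SelmerCompanions, Thm. 3.1 (iv)(b) (pp. 404–405); §5.3 Prop. 5.8 with Remark 5.9 (p. 411); §6 Def. 6.2 (p. 412), Thm. 6.1 (iv) (pp. 411–412), proof Case 5 (p. 413) and proof of Thm. 3.1 (p. 414) = arXiv:1203.0620 items 27–30] -/
def selmerLocalKer_iff_of_goodReduction_above : Prop :=
  ∀ {K : Type} [Field K] [NumberField K] (W W' : WeierstrassCurve K) [W.IsElliptic]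
    [W'.IsElliptic] (p : ℕ) [Fact p.Prime], p ≠ 2 →
    ∀ (θ : geomTorsion W' (p : ℤ) ≃+ geomTorsion W (p : ℤ))
      (hθ : ∀ (σ : absoluteGaloisGroup K) (P : geomTorsion W' (p : ℤ)), θ (σ • P) = σ • θ P)
      (v : HeightOneSpectrum (𝓞 K)),
      (p : 𝓞 K) ∈ v.asIdeal → v.asIdeal.ramificationIdx ℤ < p - 1 →
      W.HasGoodReductionAt v → W'.HasGoodReductionAt v →
      ∀ c : galH1Torsion W' (p : ℤ),
        c ∈ selmerLocalKer W' (v.adicCompletion K) (p : ℤ) ↔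
          h1Equiv θ hθ c ∈ selmerLocalKer W (v.adicCompletion K) (p : ℤ)

/-! ### Proved consequences -/

section Consequences

variable {K : Type} [Field K] [NumberField K] (W : WeierstrassCurve K) [W.IsElliptic]
  {p : ℕ} [hp : Fact p.Prime]

/-- The `hagree`-shaped projection: at a place `v ∣ p` with `e(v|p) < p − 1` where BOTH curves have good
reduction, `θ_* 𝓢_v(E') ≤ 𝓢_v(E)`. Conditional on the named fact.
[cite: MazurRubin2015SelmerCompanions, §6 proof Case 5 and proof of Thm. 3.1] -/
theorem selmerLocalKer_le_of_goodReduction_above (hMR : selmerLocalKer_iff_of_goodReduction_above)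
    (hp2 : p ≠ 2) (W' : WeierstrassCurve K) [W'.IsElliptic]
    (θ : geomTorsion W' (p : ℤ) ≃+ geomTorsion W (p : ℤ))
    (hθ : ∀ (σ : absoluteGaloisGroup K) (P : geomTorsion W' (p : ℤ)), θ (σ • P) = σ • θ P)
    (v : HeightOneSpectrum (𝓞 K)) (hv : (p : 𝓞 K) ∈ v.asIdeal)
    (hram : v.asIdeal.ramificationIdx ℤ < p - 1)
    (hW : W.HasGoodReductionAt v) (hW' : W'.HasGoodReductionAt v)
    {c : galH1Torsion W' (p : ℤ)} (hc : c ∈ selmerLocalKer W' (v.adicCompletion K) (p : ℤ)) :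
    h1Equiv θ hθ c ∈ selmerLocalKer W (v.adicCompletion K) (p : ℤ) :=
  (hMR W W' p hp2 θ hθ v hv hram hW hW' c).mp hc

/-- **The fact over `ℚ`** (the ramification clause is automatic: `e(ℚ_p/ℚ_p) = 1 < p − 1` for `p` odd,
`Fisher2016.ramificationIdx_int_rat_eq_one`): for elliptic curves `E = W`, `E' = W'` over `ℚ`, an odd prime `p`,
a `Γ_ℚ`-isomorphism `θ : E'[p] ⥲ E[p]` and the place `v` over `p`, if BOTH curves have good reduction at `p`
then `c ∈ 𝓢_v(E') ↔ θ_* c ∈ 𝓢_v(E)`. Conditional on the named fact.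
[cite: MazurRubin2015SelmerCompanions, Thm. 3.1 (iv)(b) and §6 proof Case 5] -/
theorem selmerLocalKer_iff_of_goodReduction_above_rat (hMR : selmerLocalKer_iff_of_goodReduction_above)
    (W W' : WeierstrassCurve ℚ) [W.IsElliptic] [W'.IsElliptic] (hp2 : p ≠ 2)
    (θ : geomTorsion W' (p : ℤ) ≃+ geomTorsion W (p : ℤ))
    (hθ : ∀ (σ : absoluteGaloisGroup ℚ) (P : geomTorsion W' (p : ℤ)), θ (σ • P) = σ • θ P)
    (v : HeightOneSpectrum (𝓞 ℚ)) (hv : (p : 𝓞 ℚ) ∈ v.asIdeal)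
    (hW : W.HasGoodReductionAt v) (hW' : W'.HasGoodReductionAt v) (c : galH1Torsion W' (p : ℤ)) :
    c ∈ selmerLocalKer W' (v.adicCompletion ℚ) (p : ℤ) ↔
      h1Equiv θ hθ c ∈ selmerLocalKer W (v.adicCompletion ℚ) (p : ℤ) := by
  refine hMR W W' p hp2 θ hθ v hv ?_ hW hW' c
  have h1 := Fisher2016.ramificationIdx_int_rat_eq_one v
  have h3 : 3 ≤ p := by
    rcases hp.out.eq_two_or_odd' with h | h
    · exact absurd h hp2
    · have := hp.out.two_le; omega
  omega

end Consequences

end Literature.NumberTheory.EllipticCurves.MazurRubin2015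

/-! ### The refined certificate shape with the fifth free kind -/

namespace WeierstrassCurve

open Literature.NumberTheory.EllipticCurves Literature.NumberTheory.EllipticCurves.Fisher2016
open Literature.NumberTheory.EllipticCurves.MazurRubin2015
open Literature.NumberTheory.GaloisRepresentations

section Local

variable {K : Type} [Field K] [NumberField K] (W : WeierstrassCurve K) [W.IsElliptic]
  {p : ℕ} [hp : Fact p.Prime]

/-- **The refined visibility certificate with FIVE free kinds.** `p` an odd prime, `θ : E'[p] ⥲ E[p]` a
`Γ_K`-isomorphism, `S ⊇ T` finite sets of finite places with both curves good and `v ∤ p` outside `S`,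
`E(K)` finite of order prime to `p`, (a) `∏_{v ∈ T} #E'(K_v)[p] · #(𝓞_v/p) < p^{rank E'(K)}`, (b) every
`v ∈ S \ T` of one of five free kinds: (i) `v ∤ p`, `E'(K_v)[p] = 0`; (ii) both split multiplicative,
`#E(K_v)[p] ≤ p`; (iii) both multiplicative of the same `γ`-class, `μ_p(K_v) = 1`; (iv) [`v ∤ p` or
`e(v|p) < p − 1`] and one curve non-split multiplicative, the other good (Fisher 2016 Thm. 4.4, `hF`); **(v)
`v ∣ p`, `e(v|p) < p − 1`, BOTH curves of good reduction at `v`** (Mazur–Rubin 2015, `hMR`). Then `Ш(E/K)`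
has a non-zero element killed by `p`. Conditional on `hU`, `hU2` (Tate uniformisation), `hF`, `hMR`.
[cite: MazurRubin2015SelmerCompanions, Thm. 3.1 (iv)(b) and §6 proof Case 5] [cite: Fisher2016Visualizing7, Thm. 4.4 (p. 106)]
[cite: CremonaMazur2000, §3 and Table 1] [cite: AgasheStein2002, Thm. 3.1 and §3.5] -/
theorem exists_sha_ne_zero_of_congr_of_places₅
    (hU : Silverman1994_thmV53_tateUniformisation.{0})
    (hU2 : Silverman1994_thmV53_corV54_tateUniformisation.{0})
    (hF : thm44_selmerLocalKer_iff_of_nonsplit_good) (hMR : selmerLocalKer_iff_of_goodReduction_above)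
    (hp2 : p ≠ 2) (W' : WeierstrassCurve K) [W'.IsElliptic]
    (θ : geomTorsion W' (p : ℤ) ≃+ geomTorsion W (p : ℤ))
    (hθ : ∀ (σ : absoluteGaloisGroup K) (P : geomTorsion W' (p : ℤ)), θ (σ • P) = σ • θ P)
    (S T : Finset (HeightOneSpectrum (𝓞 K))) (hTS : T ⊆ S)
    (hS : ∀ w : HeightOneSpectrum (𝓞 K), w ∉ S →
      W.HasGoodReductionAt w ∧ W'.HasGoodReductionAt w ∧ (p : 𝓞 K) ∉ w.asIdeal)
    (hfin : Finite W.toAffine.Point) (hcop : (Nat.card W.toAffine.Point).Coprime p)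
    (hT : (∏ w ∈ T, Nat.card (nsmulAddMonoidHom p :
        (W'.baseChange (w.adicCompletion K)).toAffine.Point →+ _).ker *
        Nat.card (w.adicCompletionIntegers K ⧸
          Ideal.span {(p : w.adicCompletionIntegers K)})) < p ^ W'.mordellWeilRank)
    (hplaces : ∀ w ∈ S, w ∉ T →
      ((p : 𝓞 K) ∉ w.asIdeal ∧ Nat.card (nsmulAddMonoidHom p :
          (W'.baseChange (w.adicCompletion K)).toAffine.Point →+ _).ker = 1) ∨
      (W.HasSplitMultiplicativeReductionAt w ∧ W'.HasSplitMultiplicativeReductionAt w ∧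
        Nat.card (nsmulAddMonoidHom p :
          (W.baseChange (w.adicCompletion K)).toAffine.Point →+ _).ker ≤ p) ∨
      (W.HasMultiplicativeReductionAt w ∧ W'.HasMultiplicativeReductionAt w ∧
        (∃ r : w.adicCompletion K, algebraMap K (w.adicCompletion K) (-(W.c₄ / W.c₆)) =
          r ^ 2 * algebraMap K (w.adicCompletion K) (-(W'.c₄ / W'.c₆))) ∧
        (∀ ζ : w.adicCompletion K, ζ ^ p = 1 → ζ = 1)) ∨
      (((p : 𝓞 K) ∉ w.asIdeal ∨ w.asIdeal.ramificationIdx ℤ < p - 1) ∧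
        ((W.HasMultiplicativeReductionAt w ∧ ¬ W.HasSplitMultiplicativeReductionAt w ∧
            W'.HasGoodReductionAt w) ∨
          (W.HasGoodReductionAt w ∧ W'.HasMultiplicativeReductionAt w ∧
            ¬ W'.HasSplitMultiplicativeReductionAt w))) ∨
      ((p : 𝓞 K) ∈ w.asIdeal ∧ w.asIdeal.ramificationIdx ℤ < p - 1 ∧
        W.HasGoodReductionAt w ∧ W'.HasGoodReductionAt w)) :
    ∃ c : W.sha, c ≠ 0 ∧ p • c = 0 := by
  have hpp : p.Prime := hp.out
  haveI := hfin
  refine exists_sha_ne_zero_of_congr_of_le_off W W' hp2 θ hθ S T hTS hS (fun w hw hwT c hc ↦ ?_) ?_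
  · rcases hplaces w hw hwT with ⟨hwp, hloc⟩ | ⟨hWw, hW'w, hcardw⟩ | ⟨hWw, hW'w, hγw, hμw⟩ |
        ⟨hram, hkind⟩ | ⟨hwp, hram, hWw, hW'w⟩
    · exact (relIndex_map_selmerLocalKer_eq_one_iff W W' θ hθ).mp
        (relIndex_map_selmerLocalKer_eq_one_of_card_torsion_eq_one W W' θ hθ hwp hloc) c hc
    · exact W.h1Equiv_mem_selmerLocalKer_of_hasSplitMultiplicativeReductionAt w hU W' θ hθ hWw
        hW'w hcardw hc
    · exact W.h1Equiv_mem_selmerLocalKer_of_hasMultiplicativeReductionAt w hU2 hp2 W' θ hθ hWw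
        hW'w hγw hμw hc
    · exact selmerLocalKer_le_of_nonsplit_good W hF hp2 W' θ hθ w hram hkind hc
    · exact selmerLocalKer_le_of_goodReduction_above W hMR hp2 W' θ hθ w hwp hram hWw hW'w hc
  · rw [index_range_zsmul_eq_one_of_coprime hcop, one_mul,
      Finset.prod_congr rfl fun w _ ↦
        (W'.natCard_kummerLocalConditionAt_adicCompletion w hpp.ne_zero)]
    exact lt_of_lt_of_le hT (pow_mordellWeilRank_le_index_range_zsmul W' hpp.ne_zero)

end Local

section Rat

variable (W : WeierstrassCurve ℚ) [W.IsElliptic] {p : ℕ} [hp : Fact p.Prime]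

/-- **The five-kind certificate over `ℚ`** (kinds (iv), (v) need NO ramification clause: `e = 1 < p − 1` for
odd `p`). For a rank-`0` curve `E/ℚ` with `#E(ℚ)` prime to `p` and a `p`-congruent partner `E'` of rank `r`:
if both curves are GOOD at `p` the place `p` is FREE (kind (v)); pay `#E'(ℚ_ℓ)[p]` at the other places of
`T`, nothing at places of kinds (i)–(v); if the total is `< p^r` then `Ш(E/ℚ)[p] ≠ 0`.
[cite: MazurRubin2015SelmerCompanions, Thm. 3.1 (iv)(b) and §6 proof Case 5] [cite: Fisher2016Visualizing7, Thm. 4.4 (p. 106)]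
[cite: CremonaMazur2000, §3 and Table 1] -/
theorem exists_sha_ne_zero_of_congr_of_places₅_rat
    (hU : Silverman1994_thmV53_tateUniformisation.{0})
    (hU2 : Silverman1994_thmV53_corV54_tateUniformisation.{0})
    (hF : thm44_selmerLocalKer_iff_of_nonsplit_good) (hMR : selmerLocalKer_iff_of_goodReduction_above)
    (hp2 : p ≠ 2) (W' : WeierstrassCurve ℚ) [W'.IsElliptic]
    (θ : geomTorsion W' (p : ℤ) ≃+ geomTorsion W (p : ℤ))
    (hθ : ∀ (σ : absoluteGaloisGroup ℚ) (P : geomTorsion W' (p : ℤ)), θ (σ • P) = σ • θ P)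
    (S T : Finset (HeightOneSpectrum (𝓞 ℚ))) (hTS : T ⊆ S)
    (hS : ∀ w : HeightOneSpectrum (𝓞 ℚ), w ∉ S →
      W.HasGoodReductionAt w ∧ W'.HasGoodReductionAt w ∧ (p : 𝓞 ℚ) ∉ w.asIdeal)
    (hfin : Finite W.toAffine.Point) (hcop : (Nat.card W.toAffine.Point).Coprime p)
    (hT : (∏ w ∈ T, Nat.card (nsmulAddMonoidHom p :
        (W'.baseChange (w.adicCompletion ℚ)).toAffine.Point →+ _).ker *
        Nat.card (w.adicCompletionIntegers ℚ ⧸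
          Ideal.span {(p : w.adicCompletionIntegers ℚ)})) < p ^ W'.mordellWeilRank)
    (hplaces : ∀ w ∈ S, w ∉ T →
      ((p : 𝓞 ℚ) ∉ w.asIdeal ∧ Nat.card (nsmulAddMonoidHom p :
          (W'.baseChange (w.adicCompletion ℚ)).toAffine.Point →+ _).ker = 1) ∨
      (W.HasSplitMultiplicativeReductionAt w ∧ W'.HasSplitMultiplicativeReductionAt w ∧
        Nat.card (nsmulAddMonoidHom p :
          (W.baseChange (w.adicCompletion ℚ)).toAffine.Point →+ _).ker ≤ p) ∨
      (W.HasMultiplicativeReductionAt w ∧ W'.HasMultiplicativeReductionAt w ∧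
        (∃ r : w.adicCompletion ℚ, algebraMap ℚ (w.adicCompletion ℚ) (-(W.c₄ / W.c₆)) =
          r ^ 2 * algebraMap ℚ (w.adicCompletion ℚ) (-(W'.c₄ / W'.c₆))) ∧
        (∀ ζ : w.adicCompletion ℚ, ζ ^ p = 1 → ζ = 1)) ∨
      ((W.HasMultiplicativeReductionAt w ∧ ¬ W.HasSplitMultiplicativeReductionAt w ∧
          W'.HasGoodReductionAt w) ∨
        (W.HasGoodReductionAt w ∧ W'.HasMultiplicativeReductionAt w ∧
          ¬ W'.HasSplitMultiplicativeReductionAt w)) ∨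
      ((p : 𝓞 ℚ) ∈ w.asIdeal ∧ W.HasGoodReductionAt w ∧ W'.HasGoodReductionAt w)) :
    ∃ c : W.sha, c ≠ 0 ∧ p • c = 0 := by
  have hram : ∀ w : HeightOneSpectrum (𝓞 ℚ), w.asIdeal.ramificationIdx ℤ < p - 1 := by
    intro w
    have h1 := ramificationIdx_int_rat_eq_one w
    have h3 : 3 ≤ p := by
      rcases hp.out.eq_two_or_odd' with h' | h'
      · exact absurd h' hp2
      · have := hp.out.two_le; omega
    omega
  refine exists_sha_ne_zero_of_congr_of_places₅ W hU hU2 hF hMR hp2 W' θ hθ S T hTS hS hfin hcop hT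
    (fun w hw hwT ↦ ?_)
  rcases hplaces w hw hwT with h | h | h | h | ⟨hwp, hWw, hW'w⟩
  · exact Or.inl h
  · exact Or.inr (Or.inl h)
  · exact Or.inr (Or.inr (Or.inl h))
  · exact Or.inr (Or.inr (Or.inr (Or.inl ⟨Or.inr (hram w), h⟩)))
  · exact Or.inr (Or.inr (Or.inr (Or.inr ⟨hwp, hram w, hWw, hW'w⟩)))

end Rat

end WeierstrassCurve

end
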